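import Summits.Ventures.PercRepro.K4LadderBridge
import Summits.Ventures.PercRepro.K4LadderLower

/-!
# PercRepro — C-025 on `T_p(M(K₄) ⊕ U_{m,m})` at the layer BELOW the first active one: the matroid bridge (p9, gen 14)

The layer `m = p + q − 4` (corank `q + 2`, the window map's minimiser layer for the block `M(K₄)`), for every level
`q ≥ 4` and every `p ≥ q + 2`. The orbits `(0,3)` and `(3,0)` are inactive there and contribute nothing to `#U`
(`orbit_sum_U_inactive`); the other five give `#U = 37c_{q−3} + 19c_{q−2} + 6c_{q−1}` and `#Y` is unchanged, so the
profile sums of `K4Matroid` reduce the count to the arithmetic of `K4LadderLower` (`k4_lower_ineq`), and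
**`rls_k4Ladder_lower`** is C-025 on `T_p(M(K₄) ⊕ U_{p+q−4, p+q−4})` for every `q ≥ 4`, `p ≥ q + 2`. With
`rls_k4Ladder` (every `m ≥ p + q − 3`) this covers every corank `≥ q + 2` of the K₄ family at every level `q ≥ 4`.
Nothing here is about any window of S4.
-/

namespace PercRepro.K4Ladder

open Set Finset PercRepro.LineLadder

/-- An INACTIVE orbit (`k₁ + k₂ + m < p + q`) contributes nothing to `#U`: the two conditions would force
`k₁ + a ≥ p` and `k₂ + (m − a) = q`. -/
lemma orbit_sum_U_inactive (p q m k₁ k₂ : ℕ) (hqp : q < p) (hin : k₁ + k₂ + m < p + q) :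
    ∑ a ∈ range (m + 1), (if min p (k₁ + a) = p ∧ min p (k₂ + (m - a)) = q then m.choose a else 0) = 0 := by
  refine Finset.sum_eq_zero fun a ha => ?_
  rw [Finset.mem_range] at ha
  rw [if_neg]
  omega

/-- **The lower-layer inequality in profile form** (`q ≥ 4`, `p ≥ q + 2`, `m = p + q − 4`): the orbit sums of
`orbit_sum_U_inactive` / `orbit_sum_U` / `orbit_sum_Y` with the multiplicities `1, 6, 19, 12, 19, 6, 1`. -/
theorem k4_lower_ineq (p q : ℕ) (hq : 4 ≤ q) (hpq : q + 2 ≤ p) :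
    phiK p q * ((0 + 6 * (if 3 ≤ q then (p + q - 4).choose (q - 3) else 0)
        + 19 * (if 3 ≤ q then (p + q - 4).choose (q - 3) else 0)
        + 12 * (if 3 ≤ q then (p + q - 4).choose (q - 3) else 0)
        + 19 * (if 2 ≤ q then (p + q - 4).choose (q - 2) else 0)
        + 6 * (if 1 ≤ q then (p + q - 4).choose (q - 1) else 0) + 0 : ℕ) : ℚ)
      ≤ ((∑ a ∈ Ico (q + 1) p, (p + q - 4).choose a + 6 * ∑ a ∈ Ico q (p - 1), (p + q - 4).choose a
        + 19 * ∑ a ∈ Ico (q - 1) (p - 2), (p + q - 4).choose a + 12 * ∑ a ∈ Ico (q - 2) (p - 3), (p + q - 4).choose a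
        + 19 * ∑ a ∈ Ico (q - 2) (p - 3), (p + q - 4).choose a + 6 * ∑ a ∈ Ico (q - 2) (p - 3), (p + q - 4).choose a
        + ∑ a ∈ Ico (q - 2) (p - 3), (p + q - 4).choose a : ℕ) : ℚ) := by
  obtain ⟨r, rfl⟩ : ∃ r, q = r + 4 := ⟨q - 4, by omega⟩
  obtain ⟨s, rfl⟩ : ∃ s, p = r + s + 6 := ⟨p - r - 6, by omega⟩
  have h := k4_lower_base r s
  rw [if_pos (by omega), if_pos (by omega), if_pos (by omega)]
  rw [show r + s + 6 + (r + 4) - 4 = 2 * r + s + 6 by omega, show r + 4 - 3 = r + 1 by omega,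
    show r + 4 - 2 = r + 2 by omega, show r + 4 - 1 = r + 3 by omega, show r + 4 + 1 = r + 5 by omega,
    show r + s + 6 - 1 = r + s + 5 by omega, show r + s + 6 - 2 = r + s + 4 by omega,
    show r + s + 6 - 3 = r + s + 3 by omega]
  have eU : (0 + 6 * (2 * r + s + 6).choose (r + 1) + 19 * (2 * r + s + 6).choose (r + 1)
      + 12 * (2 * r + s + 6).choose (r + 1) + 19 * (2 * r + s + 6).choose (r + 2)
      + 6 * (2 * r + s + 6).choose (r + 3) + 0 : ℕ)
      = 37 * (2 * r + s + 6).choose (r + 1) + 19 * (2 * r + s + 6).choose (r + 2)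
        + 6 * (2 * r + s + 6).choose (r + 3) := by ring
  have eY : (∑ a ∈ Ico (r + 5) (r + s + 6), (2 * r + s + 6).choose a
      + 6 * ∑ a ∈ Ico (r + 4) (r + s + 5), (2 * r + s + 6).choose a
      + 19 * ∑ a ∈ Ico (r + 3) (r + s + 4), (2 * r + s + 6).choose a
      + 12 * ∑ a ∈ Ico (r + 2) (r + s + 3), (2 * r + s + 6).choose a
      + 19 * ∑ a ∈ Ico (r + 2) (r + s + 3), (2 * r + s + 6).choose a
      + 6 * ∑ a ∈ Ico (r + 2) (r + s + 3), (2 * r + s + 6).choose a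
      + ∑ a ∈ Ico (r + 2) (r + s + 3), (2 * r + s + 6).choose a : ℕ)
      = ∑ a ∈ Ico (r + 5) (r + s + 6), (2 * r + s + 6).choose a
        + 6 * ∑ a ∈ Ico (r + 4) (r + s + 5), (2 * r + s + 6).choose a
        + 19 * ∑ a ∈ Ico (r + 3) (r + s + 4), (2 * r + s + 6).choose a
        + 38 * ∑ a ∈ Ico (r + 2) (r + s + 3), (2 * r + s + 6).choose a := by ring
  rw [eU, eY]
  exact h

variable {α : Type}

/-- **C-025 ON `T_p(M(K₄) ⊕ U_{m,m})` AT THE LAYER BELOW THE FIRST ACTIVE ONE** (`m = p + q − 4`, corank `q + 2`: the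
window map's minimiser layer of the K₄ family), every level `q ≥ 4`, every `p ≥ q + 2`. -/
theorem rls_k4Ladder_lower (e : Fin 6 ↪ α) {F : Set α} (hF : F.Finite)
    (hEF : Disjoint (K4.mapEmbedding e).E (Matroid.freeOn F).E) {p q : ℕ} (hFm : F.ncard = p + q - 4)
    (hq : 4 ≤ q) (hpq : q + 2 ≤ p) :
    @ThmN.RLS α (@PercRepro.Matroid.truncate α ((K4.mapEmbedding e).disjointSum (Matroid.freeOn F) hEF)
        (@blockFree_finite α _ (mapK4_finite e) F hF hEF) p)
      (@PercRepro.Matroid.truncate_finite α _ (@blockFree_finite α _ (mapK4_finite e) F hF hEF) p) p q := by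
  haveI := mapK4_finite e
  unfold ThmN.RLS
  rw [ncard_U_blockFree' (K4.mapEmbedding e) hF hEF p q, ncard_Y_blockFree' (K4.mapEmbedding e) hF hEF p q, hFm,
    finite_subsets_eq, Finset.sum_image (fun _ _ _ _ h => image_coe_injective e h),
    Finset.sum_image (fun _ _ _ _ h => image_coe_injective e h)]
  simp only [mapK4_eRk, mapK4_eRk_compl, ENat.toNat_coe]
  show phiK p q * ((∑ x : Finset (Fin 6), orbU p q (p + q - 4) (profile x) : ℕ) : ℚ)
    ≤ ((∑ x : Finset (Fin 6), orbY p q (p + q - 4) (profile x) : ℕ) : ℚ)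
  rw [sum_profile (orbU p q (p + q - 4)), sum_profile (orbY p q (p + q - 4))]
  simp only [orbU, orbY]
  have hqp : q < p := by omega
  rw [orbit_sum_U_inactive p q (p + q - 4) 0 3 hqp (by omega),
    orbit_sum_U p q (p + q - 4) 1 3 hqp (by omega),
    orbit_sum_U p q (p + q - 4) 2 3 hqp (by omega),
    orbit_sum_U p q (p + q - 4) 3 3 hqp (by omega),
    orbit_sum_U p q (p + q - 4) 3 2 hqp (by omega),
    orbit_sum_U p q (p + q - 4) 3 1 hqp (by omega),
    orbit_sum_U_inactive p q (p + q - 4) 3 0 hqp (by omega),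
    orbit_sum_Y p q (p + q - 4) 0, orbit_sum_Y p q (p + q - 4) 1, orbit_sum_Y p q (p + q - 4) 2,
    orbit_sum_Y p q (p + q - 4) 3]
  rw [show q + 1 - 0 = q + 1 by omega, show p - 0 = p by omega, show q + 1 - 1 = q by omega,
    show q + 1 - 2 = q - 1 by omega, show q + 1 - 3 = q - 2 by omega]
  exact k4_lower_ineq p q hq hpq

end PercRepro.K4Ladder
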